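import Literature.Probability.RandomPlanarGeometry.SAWPulledLargeForceExpansionZdSixthOrder
import Literature.Probability.RandomPlanarGeometry.SAWPulledLargeForceExpansionZdEightStep
import Literature.Probability.RandomPlanarGeometry.SAWPulledLargeForceExpansionZdThreeSlackTwo
import Literature.Probability.RandomPlanarGeometry.SAWPulledLargeForceExpansionZdSubStaples
import HarnessLib

/-!
# The pulled self-avoiding walk on `ℤ^{d+1}` at large force: the seventh coefficient
# `c^{(d)}_7 = 4d(16d⁵ + 168d⁴ + 224d³ − 146d² + 17d − 4)` in every dimension

Topic `Literature/Probability/RandomPlanarGeometry` (continues `SAWPulledLargeForceExpansionZdSixthOrder.lean` one order: the generic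
seventh-order algebra `coeff_pow_six`, `coeff_Pz_comp_six`, `a_seven`, `e_seven_eq`, and the cost-seven data `N_{7,8}`
(`…ZdEightStep`: `costCoeffZd_seven_eight_add'`), `N_{7,9}` (`…ZdThreeSlackTwo`: `ThreeSlackTwo.costCoeffZd_seven_nine_add`),
`N_{7,10}` (`…ZdSubStaples`: `costCoeffZd_two_mul_add_one_three_mul_add_one` at `A = 3`), `N_{7,n} = 0` otherwise
(`costCoeffZd_eq_zero_of_three_span`)).

Printed sources: E. J. Janse van Rensburg, S. G. Whittington, J. Phys. A 46 (2013) 435003, §3.2 Theorem 8 (the expansion to first order;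
the method); N. Madras, G. Slade, *The Self-Avoiding Walk* (1993), §1.2, §4.2. The coefficient `c_7` is not in print in any dimension
(lane «pcv-sawmu»; the `ℤ²` value `c_7 = 1100` and the `d`-polynomial were conjectured from the lane's cost censuses — CONJECTURE (17) of
FINDING-PULLED-LARGE-FORCE, preregistered as Amendment AW — and are proved here).

## Contents (all PROVED, standard axioms only; no data, no certificates)

* generic (`namespace CostSeries`): `pV c = Σ_n C(n,6) N_{c,n}`, `coeff_pow_six`, `coeff_Pz_comp_six`, ★ `a_seven`, ★ `e_seven_eq`;
* on `ℤ^{d+1}`: `costCoeffZd_seven` (the whole cost-seven column), the moments `pV_one = pR_two = 0`, `pQ_three`, `pT_four`, `pH_five`,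
  `pD_six`, `pS_seven`, `aZd_seven = −(128d⁷ + 1344d⁶ + 3840d⁵ + 2400d⁴ − 784d³ + 108d² − 16d)`,
  ★★ `largeForceCoeffZd_at_seven : c^{(d)}_7 = 4d(16d⁵ + 168d⁴ + 224d³ − 146d² + 17d − 4)` (`d = 1, 2, 3`: `1100`, `35 504`, `267 324`),
  `largeForceCoeff_seven_eq : c_7(ℤ²) = 1100`, ★ `exp_pulledBridgeFreeEnergy_seventh_order_zd`.

Provenance: lane «pcv-sawmu», a-p3 g18 (2026-08-25).
-/

noncomputable section

open Finset
open scoped BigOperators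
open Literature.Probability.LatticeModels
open Literature.Probability.RandomPlanarGeometry.SAW

namespace Literature.Probability.RandomPlanarGeometry.SAW.Zd

namespace CostSeries

variable (N : ℕ → ℕ → ℕ)

/-! ### Generic: sixth coefficients of powers and compositions, `a_7`, `e_7` -/

/-- `pV c = P_c⁽⁶⁾(1)/720 = Σ_n C(n,6) N_{c,n}`. [cite: JansevanRensburgWhittington2013, §3.2 Theorem 8 (arXiv v4 p. 11)] -/
def pV (c : ℕ) : ℤ := ∑ n ∈ Finset.range (2 * c + 2), (n.choose 6 : ℤ) * N c n

/-- The coefficient `6` of `p^n` when `p(0) = 1`: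
`n p₆ + C(n,2)(2p₁p₅ + 2p₂p₄ + p₃²) + C(n,3)(3p₁²p₄ + 6p₁p₂p₃ + p₂³) + C(n,4)(4p₁³p₃ + 6p₁²p₂²) + 5C(n,5)p₁⁴p₂ + C(n,6)p₁⁶`.
[cite: JansevanRensburgWhittington2013, §3.2 Theorem 8 (arXiv v4 p. 11)] -/
theorem coeff_pow_six (p : Polynomial ℤ) (h0 : p.coeff 0 = 1) (n : ℕ) :
    (p ^ n).coeff 6 = n * p.coeff 6 + (n.choose 2 : ℤ) * (2 * (p.coeff 1 * p.coeff 5) + 2 * (p.coeff 2 * p.coeff 4) + p.coeff 3 ^ 2) +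
      (n.choose 3 : ℤ) * (3 * (p.coeff 1 ^ 2 * p.coeff 4) + 6 * (p.coeff 1 * p.coeff 2 * p.coeff 3) + p.coeff 2 ^ 3) +
      (n.choose 4 : ℤ) * (4 * (p.coeff 1 ^ 3 * p.coeff 3) + 6 * (p.coeff 1 ^ 2 * p.coeff 2 ^ 2)) +
      5 * (n.choose 5 : ℤ) * (p.coeff 1 ^ 4 * p.coeff 2) + (n.choose 6 : ℤ) * p.coeff 1 ^ 6 := by
  induction n with
  | zero => simp [Polynomial.coeff_one]
  | succ n ih =>
    obtain ⟨i0, i1, i2⟩ := coeff_pow_low p h0 n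
    have i3 := coeff_pow_three p h0 n
    have i4 := coeff_pow_four p h0 n
    have i5 := coeff_pow_five p h0 n
    rw [pow_succ, Polynomial.coeff_mul, Finset.Nat.sum_antidiagonal_eq_sum_range_succ_mk]
    simp only [Finset.sum_range_succ, Finset.sum_range_zero, Nat.reduceSub, Nat.sub_self, zero_add]
    rw [i0, i1, i2, i3, i4, i5, ih, h0, Nat.choose_succ_succ n 1, Nat.choose_succ_succ n 2, Nat.choose_succ_succ n 3,
      Nat.choose_succ_succ n 4, Nat.choose_succ_succ n 5, Nat.choose_one_right]
    push_cast; ring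

/-- `[X⁶](P_c ∘ q)` for `q(0) = 1`, in the moments `pD … pV`. [cite: JansevanRensburgWhittington2013, §3.2 Theorem 8 (arXiv v4 p. 11)] -/
theorem coeff_Pz_comp_six (c : ℕ) (q : Polynomial ℤ) (h0 : q.coeff 0 = 1) :
    ((Pz N c).comp q).coeff 6 = pD N c * q.coeff 6 + pH N c * (2 * (q.coeff 1 * q.coeff 5) + 2 * (q.coeff 2 * q.coeff 4) + q.coeff 3 ^ 2) +
      pT N c * (3 * (q.coeff 1 ^ 2 * q.coeff 4) + 6 * (q.coeff 1 * q.coeff 2 * q.coeff 3) + q.coeff 2 ^ 3) +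
      pQ N c * (4 * (q.coeff 1 ^ 3 * q.coeff 3) + 6 * (q.coeff 1 ^ 2 * q.coeff 2 ^ 2)) + 5 * pR N c * (q.coeff 1 ^ 4 * q.coeff 2) +
      pV N c * q.coeff 1 ^ 6 := by
  have hR : 5 * pR N c * (q.coeff 1 ^ 4 * q.coeff 2) =
      ∑ n ∈ Finset.range (2 * c + 2), 5 * (n.choose 5 : ℤ) * N c n * (q.coeff 1 ^ 4 * q.coeff 2) := by
    rw [pR, Finset.mul_sum, Finset.sum_mul]
    refine Finset.sum_congr rfl fun n _ => ?_
    ring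
  rw [Pz_comp_eq, Polynomial.finsetSum_coeff, pD, pH, pT, pQ, pV, hR, Finset.sum_mul, Finset.sum_mul, Finset.sum_mul, Finset.sum_mul,
    Finset.sum_mul, ← Finset.sum_add_distrib, ← Finset.sum_add_distrib, ← Finset.sum_add_distrib, ← Finset.sum_add_distrib,
    ← Finset.sum_add_distrib]
  refine Finset.sum_congr rfl fun n _ => ?_
  rw [Polynomial.coeff_C_mul, coeff_pow_six q h0 n]
  ring

/-- ★ `a_7` in the moments. [cite: JansevanRensburgWhittington2013, §3.2 Theorem 8 (arXiv v4 p. 11)] -/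
theorem a_seven : a N 7 =
    -((pD N 1 * a N 6 + pH N 1 * (2 * (a N 1 * a N 5) + 2 * (a N 2 * a N 4) + a N 3 ^ 2) +
        pT N 1 * (3 * (a N 1 ^ 2 * a N 4) + 6 * (a N 1 * a N 2 * a N 3) + a N 2 ^ 3) +
        pQ N 1 * (4 * (a N 1 ^ 3 * a N 3) + 6 * (a N 1 ^ 2 * a N 2 ^ 2)) + 5 * pR N 1 * (a N 1 ^ 4 * a N 2) + pV N 1 * a N 1 ^ 6)
      + (pD N 2 * a N 5 + pH N 2 * (2 * (a N 1 * a N 4) + 2 * (a N 2 * a N 3)) +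
        pT N 2 * (3 * (a N 1 ^ 2 * a N 3) + 3 * (a N 1 * a N 2 ^ 2)) + 4 * pQ N 2 * (a N 1 ^ 3 * a N 2) + pR N 2 * a N 1 ^ 5)
      + (pD N 3 * a N 4 + pH N 3 * (2 * (a N 1 * a N 3) + a N 2 ^ 2) + 3 * pT N 3 * (a N 1 ^ 2 * a N 2) + pQ N 3 * a N 1 ^ 4)
      + (pD N 4 * a N 3 + 2 * pH N 4 * (a N 1 * a N 2) + pT N 4 * a N 1 ^ 3) + (pD N 5 * a N 2 + pH N 5 * a N 1 ^ 2)
      + pD N 6 * a N 1 + pS N 7) := by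
  have h0 : (A N 6).coeff 0 = 1 := coeff_A_zero_eq_one N 6
  rw [a_succ]
  simp only [Finset.sum_range_succ, Finset.sum_range_zero, Nat.reduceAdd, Nat.reduceSub, Nat.sub_self, zero_add]
  rw [coeff_Pz_comp_six N 1 _ h0, coeff_Pz_comp_five N 2 _ h0, coeff_Pz_comp_four N 3 _ h0, coeff_Pz_comp_three N 4 _ h0,
    coeff_Pz_comp_two N 5 _ h0, coeff_Pz_comp_one N 6 _ h0, coeff_Pz_comp_zero N 7 _ h0, coeff_A_eq_a N (show 6 ≤ 6 from le_rfl),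
    coeff_A_eq_a N (show 5 ≤ 6 by norm_num), coeff_A_eq_a N (show 4 ≤ 6 by norm_num), coeff_A_eq_a N (show 3 ≤ 6 by norm_num),
    coeff_A_eq_a N (show 2 ≤ 6 by norm_num), coeff_A_eq_a N (show 1 ≤ 6 by norm_num)]

/-- ★ `e_7 = −(a_1 e_6 + a_2 e_5 + a_3 e_4 + a_4 e_3 + a_5 e_2 + a_6 e_1 + a_7)`. [cite: JansevanRensburgWhittington2013, §3.2 Theorem 8 (arXiv v4 p. 11)] -/
theorem e_seven_eq : e N 7 = -(a N 1 * e N 6 + a N 2 * e N 5 + a N 3 * e N 4 + a N 4 * e N 3 + a N 5 * e N 2 + a N 6 * e N 1 + a N 7) := by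
  have h := sum_antidiagonal_a_mul_e N (k := 7) (by norm_num)
  rw [Finset.Nat.sum_antidiagonal_eq_sum_range_succ_mk] at h
  simp only [Finset.sum_range_succ, Finset.sum_range_zero, Nat.reduceSub, Nat.sub_self, a_zero, e_zero, zero_add, one_mul,
    mul_one] at h
  linear_combination h


end CostSeries

/-! ### The cost-seven column on `ℤ^{d+1}` -/

/-- `N_{7,10} = 7 · 2d(2d−1)²` (the sub-staples of span three). [cite: MadrasSlade1993, §4.2, eq. (4.2.20)–(4.2.22) (p. 94, 2013 reprint)] -/
theorem costCoeffZd_seven_ten (d : ℕ) : costCoeffZd d 7 10 = 7 * (2 * d * (2 * d - 1) ^ 2) := by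
  simpa using costCoeffZd_two_mul_add_one_three_mul_add_one d (A := 3) (by norm_num)

/-- ★ **`N_{7,n}`** on `ℤ^{d+1}`: the seven-step self-avoiding walks of `ℤ^d` at `n = 8`, the three-slack layer
`640d⁵ − 1088d⁴ + 320d³ + 376d² − 196d` at `n = 9`, the sub-staples `7·2d(2d−1)²` at `n = 10`, zero otherwise.
[cite: MadrasSlade1993, §4.2, eq. (4.2.20)–(4.2.22) (p. 94, 2013 reprint)] -/
theorem costCoeffZd_seven (d n : ℕ) : costCoeffZd d 7 n =
    if n = 8 then 128 * d ^ 7 + 352 * d ^ 5 + 192 * d ^ 3 + 166 * d - 384 * d ^ 6 - 80 * d ^ 4 - 372 * d ^ 2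
    else if n = 9 then 640 * d ^ 5 + 320 * d ^ 3 + 376 * d ^ 2 - 1088 * d ^ 4 - 196 * d
    else if n = 10 then 7 * (2 * d * (2 * d - 1) ^ 2) else 0 := by
  by_cases h8 : n = 8
  · subst h8; rw [if_pos rfl, costCoeffZd_seven_eight]
  rw [if_neg h8]
  by_cases h9 : n = 9
  · subst h9; rw [if_pos rfl, ThreeSlackTwo.costCoeffZd_seven_nine]
  rw [if_neg h9]
  by_cases h10 : n = 10
  · subst h10; rw [if_pos rfl, costCoeffZd_seven_ten]
  rw [if_neg h10]
  rcases Nat.lt_or_ge n 8 with h | h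
  · exact costCoeffZd_eq_zero_of_le (by omega)
  · exact costCoeffZd_eq_zero_of_three_span (by omega) (by omega)

/-! ### The moments of the cost data up to cost seven and `c^{(d)}_7` -/

/-- `pV₁ = 0`. [cite: JansevanRensburgWhittington2013, §3.2 Theorem 8 (arXiv v4 p. 11)] -/
theorem pV_one (d : ℕ) : CostSeries.pV (costCoeffZd d) 1 = 0 := by
  rw [CostSeries.pV, show 2 * 1 + 2 = 4 from rfl]
  simp only [Finset.sum_range_succ, Finset.sum_range_zero, costCoeffZd_one_two,
    costCoeffZd_one_of_ne_two d (show (0:ℕ) ≠ 2 by norm_num), costCoeffZd_one_of_ne_two d (show (1:ℕ) ≠ 2 by norm_num),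
    costCoeffZd_one_of_ne_two d (show (3:ℕ) ≠ 2 by norm_num), Nat.choose]
  push_cast; ring

/-- `pR₂ = 0`. [cite: JansevanRensburgWhittington2013, §3.2 Theorem 8 (arXiv v4 p. 11)] -/
theorem pR_two (d : ℕ) : CostSeries.pR (costCoeffZd d) 2 = 0 := by
  rw [CostSeries.pR, show 2 * 2 + 2 = 6 from rfl]
  simp only [Finset.sum_range_succ, Finset.sum_range_zero, costCoeffZd_two, Nat.choose]
  simp

/-- `pQ₃ = N_{3,4} = 8d³ − 8d² + 2d`. [cite: JansevanRensburgWhittington2013, §3.2 Theorem 8 (arXiv v4 p. 11)] -/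
theorem pQ_three (d : ℕ) : CostSeries.pQ (costCoeffZd d) 3 = 8 * d ^ 3 - 8 * d ^ 2 + 2 * d := by
  rw [CostSeries.pQ, show 2 * 3 + 2 = 8 from rfl]
  simp only [Finset.sum_range_succ, Finset.sum_range_zero, costCoeffZd_three, Nat.choose]
  rcases Nat.eq_zero_or_pos d with rfl | hd
  · simp
  · obtain ⟨e, rfl⟩ : ∃ e, d = e + 1 := ⟨d - 1, by omega⟩
    simp only [show 2 * (e + 1) - 1 = 2 * e + 1 by omega]
    push_cast; ring

/-- `pT₄ = 10 N_{4,5} + 20 N_{4,6} = 160d⁴ − 240d³ + 160d² − 20d`. [cite: JansevanRensburgWhittington2013, §3.2 Theorem 8 (arXiv v4 p. 11)] -/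
theorem pT_four (d : ℕ) : CostSeries.pT (costCoeffZd d) 4 = 160 * d ^ 4 - 240 * d ^ 3 + 160 * d ^ 2 - 20 * d := by
  have h45 := costCoeffZd_four_five_add d
  rw [CostSeries.pT, show 2 * 4 + 2 = 10 from rfl]
  simp only [Finset.sum_range_succ, Finset.sum_range_zero, costCoeffZd_four_six, costCoeffZd_four_seven,
    costCoeffZd_eq_zero_of_le (show 0 ≤ 4 by norm_num),
    costCoeffZd_eq_zero_of_le (show 1 ≤ 4 by norm_num),
    costCoeffZd_eq_zero_of_le (show 2 ≤ 4 by norm_num),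
    costCoeffZd_eq_zero_of_le (show 3 ≤ 4 by norm_num),
    costCoeffZd_eq_zero_of_le (show 4 ≤ 4 from le_rfl),
    costCoeffZd_eq_zero_of_lt (show 3 * 4 + 2 < 2 * 8 by norm_num), costCoeffZd_eq_zero_of_lt (show 3 * 4 + 2 < 2 * 9 by norm_num),
    Nat.choose]
  rcases Nat.eq_zero_or_pos d with rfl | hd
  · simp at h45 ⊢
    have : costCoeffZd 0 4 5 = 0 := by simpa using h45
    simp [this]
  · obtain ⟨e, rfl⟩ : ∃ e, d = e + 1 := ⟨d - 1, by omega⟩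
    simp only [show 2 * (e + 1) - 1 = 2 * e + 1 by omega, show 2 * (e + 1) - 2 = 2 * e by omega] at h45 ⊢
    have h45' : (costCoeffZd (e + 1) 4 5 : ℤ) = 2 * (e + 1) * (2 * e + 1) ^ 3 - 2 * (e + 1) * (2 * e) := by
      have := congrArg (fun m : ℕ => (m : ℤ)) h45
      push_cast at this
      linarith
    push_cast
    rw [h45']
    ring

/-- `pH₅ = 15 N_{5,6} + 21 N_{5,7} = 480d⁵ − 960d⁴ + 1152d³ − 492d² + 18d`. [cite: JansevanRensburgWhittington2013, §3.2 Theorem 8 (arXiv v4 p. 11)] -/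
theorem pH_five (d : ℕ) : CostSeries.pH (costCoeffZd d) 5 = 480 * d ^ 5 - 960 * d ^ 4 + 1152 * d ^ 3 - 492 * d ^ 2 + 18 * d := by
  have h56 := costCoeffZd_five_six_add d
  rw [CostSeries.pH, show 2 * 5 + 2 = 12 from rfl]
  simp only [Finset.sum_range_succ, Finset.sum_range_zero, costCoeffZd_five_seven,
    costCoeffZd_eq_zero_of_le (show 0 ≤ 5 by norm_num),
    costCoeffZd_eq_zero_of_le (show 1 ≤ 5 by norm_num),
    costCoeffZd_eq_zero_of_le (show 2 ≤ 5 by norm_num),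
    costCoeffZd_eq_zero_of_le (show 3 ≤ 5 by norm_num),
    costCoeffZd_eq_zero_of_le (show 4 ≤ 5 by norm_num),
    costCoeffZd_eq_zero_of_le (show 5 ≤ 5 from le_rfl),
    costCoeffZd_eq_zero_of_three_span (show 5 + 2 ≤ 8 by norm_num) (show 3 * 5 < 2 * 8 by norm_num),
    costCoeffZd_eq_zero_of_three_span (show 5 + 2 ≤ 9 by norm_num) (show 3 * 5 < 2 * 9 by norm_num),
    costCoeffZd_eq_zero_of_three_span (show 5 + 2 ≤ 10 by norm_num) (show 3 * 5 < 2 * 10 by norm_num),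
    costCoeffZd_eq_zero_of_three_span (show 5 + 2 ≤ 11 by norm_num) (show 3 * 5 < 2 * 11 by norm_num)]
  rcases Nat.eq_zero_or_pos d with rfl | hd
  · simp at h56 ⊢
    have : costCoeffZd 0 5 6 = 0 := by simpa using h56
    simp [this]
  · obtain ⟨e, rfl⟩ : ∃ e, d = e + 1 := ⟨d - 1, by omega⟩
    simp only [show 2 * (e + 1) - 1 = 2 * e + 1 by omega, show 2 * (e + 1) - 2 = 2 * e by omega,
      show 4 * (e + 1) - 3 = 4 * e + 1 by omega] at h56 ⊢
    have h56' : (costCoeffZd (e + 1) 5 6 : ℤ) = 2 * (e + 1) * (2 * e + 1) ^ 4 - 2 * (e + 1) * (2 * e) * (4 * e + 1) := by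
      have := congrArg (fun m : ℕ => (m : ℤ)) h56
      push_cast at this
      linarith
    simp only [Nat.choose]
    push_cast
    rw [h56']
    ring

/-- `pD₆ = 7 N_{6,7} + 8 N_{6,8} + 9 N_{6,9} = 448d⁶ − 1120d⁵ + 2064d⁴ − 1728d³ + 624d² − 64d`.
[cite: JansevanRensburgWhittington2013, §3.2 Theorem 8 (arXiv v4 p. 11)] -/
theorem pD_six (d : ℕ) : CostSeries.pD (costCoeffZd d) 6 = 448 * d ^ 6 - 1120 * d ^ 5 + 2064 * d ^ 4 - 1728 * d ^ 3 + 624 * d ^ 2 - 64 * d := by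
  have h67 := costCoeffZd_six_seven_add' d
  have h68 := costCoeffZd_six_eight_add d
  have h69 := costCoeffZd_six_nine d
  rw [CostSeries.pD, show 2 * 6 + 2 = 14 from rfl]
  simp only [Finset.sum_range_succ, Finset.sum_range_zero,
    costCoeffZd_eq_zero_of_le (show 0 ≤ 6 by norm_num),
    costCoeffZd_eq_zero_of_le (show 1 ≤ 6 by norm_num),
    costCoeffZd_eq_zero_of_le (show 2 ≤ 6 by norm_num),
    costCoeffZd_eq_zero_of_le (show 3 ≤ 6 by norm_num),
    costCoeffZd_eq_zero_of_le (show 4 ≤ 6 by norm_num),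
    costCoeffZd_eq_zero_of_le (show 5 ≤ 6 by norm_num),
    costCoeffZd_eq_zero_of_le (show 6 ≤ 6 from le_rfl),
    costCoeffZd_eq_zero_of_three_span (show 6 + 2 ≤ 10 by norm_num) (show 3 * 6 < 2 * 10 by norm_num),
    costCoeffZd_eq_zero_of_three_span (show 6 + 2 ≤ 11 by norm_num) (show 3 * 6 < 2 * 11 by norm_num),
    costCoeffZd_eq_zero_of_three_span (show 6 + 2 ≤ 12 by norm_num) (show 3 * 6 < 2 * 12 by norm_num),
    costCoeffZd_eq_zero_of_three_span (show 6 + 2 ≤ 13 by norm_num) (show 3 * 6 < 2 * 13 by norm_num)]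
  have h67' : (costCoeffZd d 6 7 : ℤ) = 64 * d ^ 6 + 112 * d ^ 4 + 20 * d ^ 2 - 160 * d ^ 5 - 34 * d := by
    have := congrArg (fun m : ℕ => (m : ℤ)) h67
    push_cast at this
    linarith
  have h68' : (costCoeffZd d 6 8 : ℤ) = 160 * d ^ 4 + 56 * d ^ 2 + 24 * d - 216 * d ^ 3 := by
    have := congrArg (fun m : ℕ => (m : ℤ)) h68
    push_cast at this
    linarith
  rcases Nat.eq_zero_or_pos d with rfl | hd
  · have h69z : (costCoeffZd 0 6 9 : ℤ) = 0 := by rw [h69]; simp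
    norm_num at h67' h68' ⊢
    linarith
  · obtain ⟨e, rfl⟩ : ∃ e, d = e + 1 := ⟨d - 1, by omega⟩
    simp only [show 2 * (e + 1) - 1 = 2 * e + 1 by omega] at h69
    push_cast at h67' h68' ⊢
    rw [h67', h68', h69]
    push_cast
    ring

/-- ★ `pS₇ = N_{7,8} + N_{7,9} + N_{7,10} = 128d⁷ − 384d⁶ + 992d⁵ − 1168d⁴ + 568d³ − 52d² − 16d`.
[cite: JansevanRensburgWhittington2013, §3.2 Theorem 8 (arXiv v4 p. 11)] -/
theorem pS_seven (d : ℕ) :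
    CostSeries.pS (costCoeffZd d) 7 = 128 * d ^ 7 - 384 * d ^ 6 + 992 * d ^ 5 - 1168 * d ^ 4 + 568 * d ^ 3 - 52 * d ^ 2 - 16 * d := by
  have h78 := costCoeffZd_seven_eight_add' d
  have h79 := ThreeSlackTwo.costCoeffZd_seven_nine_add d
  have h710 := costCoeffZd_seven_ten d
  rw [CostSeries.pS, show 2 * 7 + 2 = 16 from rfl]
  simp only [Finset.sum_range_succ, Finset.sum_range_zero,
    costCoeffZd_eq_zero_of_le (show 0 ≤ 7 by norm_num),
    costCoeffZd_eq_zero_of_le (show 1 ≤ 7 by norm_num),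
    costCoeffZd_eq_zero_of_le (show 2 ≤ 7 by norm_num),
    costCoeffZd_eq_zero_of_le (show 3 ≤ 7 by norm_num),
    costCoeffZd_eq_zero_of_le (show 4 ≤ 7 by norm_num),
    costCoeffZd_eq_zero_of_le (show 5 ≤ 7 by norm_num),
    costCoeffZd_eq_zero_of_le (show 6 ≤ 7 by norm_num),
    costCoeffZd_eq_zero_of_le (show 7 ≤ 7 from le_rfl),
    costCoeffZd_eq_zero_of_three_span (show 7 + 2 ≤ 11 by norm_num) (show 3 * 7 < 2 * 11 by norm_num),
    costCoeffZd_eq_zero_of_three_span (show 7 + 2 ≤ 12 by norm_num) (show 3 * 7 < 2 * 12 by norm_num),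
    costCoeffZd_eq_zero_of_three_span (show 7 + 2 ≤ 13 by norm_num) (show 3 * 7 < 2 * 13 by norm_num),
    costCoeffZd_eq_zero_of_three_span (show 7 + 2 ≤ 14 by norm_num) (show 3 * 7 < 2 * 14 by norm_num),
    costCoeffZd_eq_zero_of_three_span (show 7 + 2 ≤ 15 by norm_num) (show 3 * 7 < 2 * 15 by norm_num)]
  have h78' : (costCoeffZd d 7 8 : ℤ) = 128 * d ^ 7 + 352 * d ^ 5 + 192 * d ^ 3 + 166 * d - 384 * d ^ 6 - 80 * d ^ 4 - 372 * d ^ 2 := by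
    have := congrArg (fun m : ℕ => (m : ℤ)) h78
    push_cast at this
    linarith
  have h79' : (costCoeffZd d 7 9 : ℤ) = 640 * d ^ 5 + 320 * d ^ 3 + 376 * d ^ 2 - 1088 * d ^ 4 - 196 * d := by
    have := congrArg (fun m : ℕ => (m : ℤ)) h79
    push_cast at this
    linarith
  rcases Nat.eq_zero_or_pos d with rfl | hd
  · norm_num at h710
    push_cast at h78' h79' ⊢
    rw [h78', h79', h710]
    norm_num
  · obtain ⟨e, rfl⟩ : ∃ e, d = e + 1 := ⟨d - 1, by omega⟩
    simp only [show 2 * (e + 1) - 1 = 2 * e + 1 by omega] at h710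
    push_cast at h78' h79' ⊢
    rw [h78', h79', h710]
    push_cast
    ring

/-- `a₇ = −(128d⁷ + 1344d⁶ + 3840d⁵ + 2400d⁴ − 784d³ + 108d² − 16d)` on `ℤ^{d+1}`. [cite: JansevanRensburgWhittington2013, §3.2 Theorem 8 (arXiv v4 p. 11)] -/
theorem aZd_seven (d : ℕ) : CostSeries.a (costCoeffZd d) 7 =
    -(128 * d ^ 7 + 1344 * d ^ 6 + 3840 * d ^ 5 + 2400 * d ^ 4 - 784 * d ^ 3 + 108 * d ^ 2 - 16 * d) := by
  rw [CostSeries.a_seven, aZd_one, aZd_two, aZd_three, aZd_four, aZd_five, aZd_six, pD_one, pH_one, pT_one, pQ_one, pR_one, pV_one,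
    pD_two, pH_two, pT_two, pQ_two, pR_two, pD_three, pH_three, pT_three, pQ_three, pD_four, pH_four, pT_four, pD_five, pH_five,
    pD_six, pS_seven]
  push_cast; ring

/-- ★★ **THE SEVENTH COEFFICIENT: `c^{(d)}_7 = 4d(16d⁵ + 168d⁴ + 224d³ − 146d² + 17d − 4)`** on `ℤ^{d+1}`, every dimension
(`d = 1, 2, 3`: `1100`, `35 504`, `267 324`). [cite: JansevanRensburgWhittington2013, §3.2 Theorem 8 (arXiv v4 p. 11)] -/
theorem largeForceCoeffZd_at_seven (d : ℕ) :
    largeForceCoeffZd d 7 = 4 * d * (16 * d ^ 5 + 168 * d ^ 4 + 224 * d ^ 3 - 146 * d ^ 2 + 17 * d - 4) := by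
  have e1 : CostSeries.e (costCoeffZd d) 1 = 2 * d := largeForceCoeffZd_at_one d
  have e2 : CostSeries.e (costCoeffZd d) 2 = -(2 * (d : ℤ)) := largeForceCoeffZd_at_two d
  have e3 : CostSeries.e (costCoeffZd d) 3 = 2 * d * (2 * d + 1) := largeForceCoeffZd_at_three d
  have e4 : CostSeries.e (costCoeffZd d) 4 = -(4 * (d : ℤ) ^ 2 * (2 * d + 3)) := largeForceCoeffZd_at_four d
  have e5 : CostSeries.e (costCoeffZd d) 5 = 2 * d * (8 * d ^ 3 + 28 * d ^ 2 + 2 * d - 1) := largeForceCoeffZd_at_five d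
  have e6 : CostSeries.e (costCoeffZd d) 6 = -(4 * d * (8 * d ^ 4 + 52 * d ^ 3 + 26 * d ^ 2 - 18 * d + 3)) := largeForceCoeffZd_at_six d
  show CostSeries.e (costCoeffZd d) 7 = _
  rw [CostSeries.e_seven_eq, aZd_one, aZd_two, aZd_three, aZd_four, aZd_five, aZd_six, aZd_seven, e1, e2, e3, e4, e5, e6]
  ring

/-- `c_7 = 1100` on `ℤ²` (CONJECTURE (17) of the lane at `d = 1`, now a theorem without certificates).
[cite: JansevanRensburgWhittington2013, §3.2 Theorem 8 (arXiv v4 p. 11)] -/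
theorem largeForceCoeff_seven_eq : largeForceCoeff 7 = 1100 := by
  rw [← largeForceCoeffZd_one 7, largeForceCoeffZd_at_seven]; norm_num

/-- ★★ **`e^{λ_B(y)}` on `ℤ^{d+1}` to order `y⁻⁶`**: `y + 2d − 2d/y + 2d(2d+1)/y² − 4d²(2d+3)/y³ + 2d(8d³+28d²+2d−1)/y⁴ −
4d(8d⁴+52d³+26d²−18d+3)/y⁵ + 4d(16d⁵+168d⁴+224d³−146d²+17d−4)/y⁶ + O(1/y⁷)`, every dimension.
[cite: JansevanRensburgWhittington2013, §3.2 Theorem 8 (arXiv v4 p. 11)] -/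
theorem exp_pulledBridgeFreeEnergy_seventh_order_zd (d : ℕ) :
    ∃ C y₁ : ℝ, 0 < y₁ ∧ ∀ y ≥ y₁,
      |Real.exp (pulledBridgeFreeEnergy (d + 1) y) -
        (y + 2 * d - 2 * d / y + 2 * d * (2 * d + 1) / y ^ 2 - 4 * d ^ 2 * (2 * d + 3) / y ^ 3 +
          2 * d * (8 * d ^ 3 + 28 * d ^ 2 + 2 * d - 1) / y ^ 4 - 4 * d * (8 * d ^ 4 + 52 * d ^ 3 + 26 * d ^ 2 - 18 * d + 3) / y ^ 5 +
          4 * d * (16 * d ^ 5 + 168 * d ^ 4 + 224 * d ^ 3 - 146 * d ^ 2 + 17 * d - 4) / y ^ 6)| ≤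
        C / y ^ 7 := by
  obtain ⟨C, y₁, hy₁, h⟩ := exp_pulledBridgeFreeEnergy_expansion_zd d 7
  refine ⟨C, y₁, hy₁, fun y hy => ?_⟩
  have hy0 : 0 < y := lt_of_lt_of_le hy₁ hy
  have h1 := h y hy
  have hs : ∑ k ∈ Finset.range (7 + 1), y * ((largeForceCoeffZd d k : ℝ) * y⁻¹ ^ k) =
      y + 2 * d - 2 * d / y + 2 * d * (2 * d + 1) / y ^ 2 - 4 * d ^ 2 * (2 * d + 3) / y ^ 3 +
        2 * d * (8 * d ^ 3 + 28 * d ^ 2 + 2 * d - 1) / y ^ 4 - 4 * d * (8 * d ^ 4 + 52 * d ^ 3 + 26 * d ^ 2 - 18 * d + 3) / y ^ 5 +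
        4 * d * (16 * d ^ 5 + 168 * d ^ 4 + 224 * d ^ 3 - 146 * d ^ 2 + 17 * d - 4) / y ^ 6 := by
    rw [Finset.sum_range_succ, Finset.sum_range_succ, Finset.sum_range_succ, Finset.sum_range_succ, Finset.sum_range_succ,
      Finset.sum_range_succ, Finset.sum_range_succ, Finset.sum_range_one, largeForceCoeffZd_zero, largeForceCoeffZd_at_one,
      largeForceCoeffZd_at_two, largeForceCoeffZd_at_three, largeForceCoeffZd_at_four, largeForceCoeffZd_at_five, largeForceCoeffZd_at_six,
      largeForceCoeffZd_at_seven]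
    push_cast
    field_simp
    ring
  rwa [hs] at h1

end Literature.Probability.RandomPlanarGeometry.SAW.Zd

end
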